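import Mathlib
import HarnessLib
import Literature.MathematicalPhysics.QuantumLattice.GrassmannWeightedEffectiveActionBoundDB
import Literature.MathematicalPhysics.QuantumLattice.GrassmannParity
import Literature.MathematicalPhysics.QuantumLattice.GrassmannFlowIteration
import Summits.HubbardSuperconductivity.HubbardSuperconductivity.Theorems.KLProgrammeKLRegimeEngineScaleZeroE4Assembly
import Summits.HubbardSuperconductivity.HubbardSuperconductivity.Theorems.KLProgrammeKLRegimeEngineE4ScaleDoor

/-!
# KL programme — scale-`0` engine: (E1-W)₀, the WEIGHTED kernel profile `KernelNormsWt … K 0` of the analysed scale-`0` action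
# in every degree, from ONE decay-weighted determinant-bounded step (modulo the three weighted sizes)

Cell gate-hubbard-kl, seat p3 (g8).  The engine-flow stub (b)-F (`stub_engine_step_norms`, template of record
`HOME/planner-g16/…SkeletonV17F.template.lean`) concludes `∀ j ≤ n, KernelNormsLevels … K_n j ∧ KernelNormsWt L M (klWtBudget … j) β U μ K_n j`
at the FIXED flow frame `K_n`; its internal level `j = 0` is the weighted profile of the analysed scale-`0` action
`map (toLin' E₀) 𝒱⁽⁰⁾`, `𝒱⁽⁰⁾ = effAction C^K_{>e₀} (map (toLin' S) (V_N + 𝒩_{K,N}))` (`…ScaleZeroNorms.klEffectiveAction_zero_eq_effAction_map`),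
`E₀ = sectorAnalysisMatrix β (klAnisoFamily … klE0 0)`, `S = hubbardGridSub L M β (4M)`, in the currency
`klWtPinnedSum L M β U μ K 0 m q w = ε_x^{m-1}·Σ_{X : X q = w} klScaleWt₀(positions X)·‖kernel (map (toLin' E₀) 𝒱⁽⁰⁾) m X‖` of `…EngineE4ScaleDoor`.
This file produces it for EVERY admissible frame `K` (the hypotheses are frame-wise sizes), modulo the SAME three weighted sizes as
k3c2-p1's (E4)₀ assembly `firstMoment_zero_le_of_wgridStep` (so one package of numbers closes both):

1. (α_w) `gridLabelWt`-pair-weighted row / column sums of `Sᵀ C^K_{>e₀} S` (LANDED for every `FrameOK` frame: `…ScaleZeroAlphaW`, p3 g8);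
2. (cr_w / cc_w) the same for the cross-grid overlap kernel `E₀ S`;
3. the smallness `θ_w = e·α_w·‖Ṽ‖_{h,wt}/κ² < 1` for the EXPLICIT weighted profile of the grid vertex (`N_w(1) = (|β|/N)Σ_z‖Ǩ(z)‖(1+|z|)`,
   `N_w(2) = |U||β|/N`, `…ScaleZeroE4GridVertex.sum_norm_kernel_gridVertex_mul_wt_le`).

* `klScaleWt_zero_le_gridLabelWt` — `klScaleWt L M β 0 S = 1 + e₀·diam(S) ≤ 1 + diam(S) = gridLabelWt L (4M) β S` (`e₀ = klE0 = 1/32`);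
* `map_sectorAnalysis_klEffectiveAction_zero_mem_evenPart`, `klWtPinnedSum_zero_eq_zero_of_odd` — odd degrees carry nothing;
* **`klWtPinnedSum_zero_le_of_wgridStep`** — degrees `2p ≥ 4`, BI-GRADED (`U^{p-1}`-shaped, the law of `klWtBudget … 0 (2p)`):
  `klWtPinnedSum … K 0 (2p) q w ≤ ε_x^{2p-1}·cr_w·cc_w^{2p-1}·(ρ^{-2p}·e f₂·(eα_w f₂/κ²)^{p-2}/(1-θ_w)^p)`, `f₂ = (e²(κ+ρ))⁴·|U||β|/(4M)`
  (`GrassmannWeightedEffectiveActionBiGradedMap.sum_wt_norm_kernel_map_effAction_le_biquartic_of_gramBounded`);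
* **`klWtPinnedSum_zero_le_of_wgridStep_full`** — every degree `m ≥ 1` (used at `m = 2`: the two-leg kernel of `𝒱⁽⁰⁾` WITH the counterterm
  and the tadpole inside): `≤ ε_x^{m-1}·cr_w·cc_w^{m-1}·(ρ^{-m}·e‖Ṽ‖_{h,wt}/(1-θ_w))`
  (`GrassmannWeightedEffectiveActionBoundDB.sum_wt_norm_kernel_effAction_le_of_gramBounded` + the weighted Young step
  `sum_filter_wt_norm_kernel_map_le_of_pos` through `E₀S`);
* **`kernelNormsWt_zero_of_wgridStep`** — for any degree budget `N` dominating these (`N (2p) ≥` the bi-graded bound for `p ≥ 2`, `N 2 ≥` the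
  full-step bound, `N m ≥ 0` for odd `m`): `KernelNormsWt L M N β U μ K 0`.

Everything is proved; no definitions, no named facts, no sorry.  References: BGM 2006 (2.13)–(2.14), (2.77)–(2.80), §3 (3.2)–(3.8)
[cite: BenfattoGiulianiMastropietro2006]; Pedra–Salmhofer 2008 Thm 2.4 [cite: PedraSalmhofer2008].  `--supports stmt-HubbardSuperconductivity-20236`.
-/

noncomputable section

namespace Summit.HubbardSuperconductivity.HubbardSuperconductivity.Theorems.EngineV8

set_option linter.dupNamespace false -- summit = problem name (single-conjunct summit), D-0017

open Real Finset Literature.MathematicalPhysics.QuantumLattice Literature.Probability.LatticeModels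
open Literature.Probability.LatticeModels.BattleFederbush
open Literature.MathematicalPhysics.QuantumLattice.GrassmannAlgebra
open Summit.HubbardSuperconductivity.HubbardSuperconductivity.Theorems.KLRegimeSplit
open Summit.HubbardSuperconductivity.HubbardSuperconductivity.Theorems.DispersionFlow
open Summit.HubbardSuperconductivity.HubbardSuperconductivity.Theorems.KLProgrammeLegKernels

variable {L M : ℕ} [NeZero L]

/-! ## §1 The scale-`0` tree weight is dominated by the (E4)₀ bookkeeping weight -/

/-- `Λ₀ = klScale klE0 0 = klE0`. -/
theorem klScale_klE0_zero : klScale klE0 0 = klE0 := by simp [klScale]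

omit [NeZero L] in
/-- **`klScaleWt L M β 0 S ≤ gridLabelWt L (4M) β S`**: `1 + e₀·diam(S) ≤ 1 + diam(S)` since `e₀ = 1/32 ≤ 1`. -/
theorem klScaleWt_zero_le_gridLabelWt (β : ℝ) (S : Finset (ZMod (2 * (2 * M)) × TorusSite 2 L)) :
    klScaleWt L M β 0 S ≤ gridLabelWt L (2 * (2 * M)) β S := by
  rw [klScaleWt_apply, gridLabelWt_apply, klScale_klE0_zero]
  have hd := labelDiam_nonneg (gridLabelDist L (2 * (2 * M)) β) S
  have he : klE0 ≤ 1 := by norm_num [klE0]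
  nlinarith

/-! ## §2 Parity: the analysed scale-`0` action is even, its odd pinned sums vanish -/

/-- **The analysed scale-`0` action `map (toLin' E₀) 𝒱⁽⁰⁾` is even** (`β ≠ 0`). -/
theorem map_sectorAnalysis_klEffectiveAction_zero_mem_evenPart [NeZero M] {β : ℝ} (hβ : β ≠ 0) (U μ : ℝ) (K : TrigPolyC4v) :
    ExteriorAlgebra.map (Matrix.toLin' (sectorAnalysisMatrix L M β (klAnisoFamily L M β μ K klE0 0)))
        (klEffectiveAction L M β U μ K klE0 0) ∈
      evenPart ℂ (SpaceTimeIdx L M × SectorLeg (sectorCount 0)) := by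
  haveI : NeZero (2 * (2 * M)) := ⟨by have := NeZero.ne M; omega⟩
  rw [klEffectiveAction_zero_eq_effAction_map hβ U μ K]
  set Vt := hubbardGridInteraction L (2 * (2 * M)) β U + hubbardGridCounterQuadratic L (2 * (2 * M)) β K with hVt
  have hVt_even : Vt ∈ evenPart ℂ (GridLeg (GridPoint L (2 * (2 * M)))) :=
    add_mem (hubbardGridInteraction_mem_evenPart β U) (hubbardGridCounterQuadratic_mem_evenPart β K)
  have hVt0 : constPart ℂ Vt = 0 := by
    rw [hVt, map_add, constPart_hubbardGridInteraction, constPart_hubbardGridCounterQuadratic, add_zero]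
  have hSV : ExteriorAlgebra.map (Matrix.toLin' (hubbardGridSub L M β (2 * (2 * M)))) Vt ∈ evenPart ℂ (HubbardFieldIdx L M) :=
    mem_evenPart_iff.2 (map_mem_evenOdd_zero ℂ _ (mem_evenPart_iff.1 hVt_even))
  have hSV0 : constPart ℂ (ExteriorAlgebra.map (Matrix.toLin' (hubbardGridSub L M β (2 * (2 * M)))) Vt) = 0 := by
    rw [constPart_map, hVt0]
  exact mem_evenPart_iff.2 (map_mem_evenOdd_zero ℂ _ (mem_evenPart_iff.1 (effAction_mem_evenPart _ hSV hSV0)))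

/-- **Odd degrees carry nothing**: `klWtPinnedSum … K 0 m q w = 0` for odd `m` (`β ≠ 0`). -/
theorem klWtPinnedSum_zero_eq_zero_of_odd [NeZero M] {β : ℝ} (hβ : β ≠ 0) (U μ : ℝ) (K : TrigPolyC4v) {m : ℕ} (hm : Odd m)
    (q : Fin m) (w : SpaceTimeIdx L M × SectorLeg (sectorCount 0)) : klWtPinnedSum L M β U μ K 0 m q w = 0 := by
  rw [klWtPinnedSum_def]
  refine mul_eq_zero_of_right _ (sum_eq_zero fun X _ => ?_)
  rw [kernel_eq_zero_of_mem_evenPart_of_odd ℂ (map_sectorAnalysis_klEffectiveAction_zero_mem_evenPart hβ U μ K) hm X, norm_zero,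
    mul_zero]

/-! ## §3 Degrees `2p ≥ 4`: the bi-graded weighted step read through `E₀S` -/

/-- **(E1-W)₀ in degrees `2p ≥ 4` from ONE decay-weighted bi-graded determinant-bounded step** (modulo the three weighted sizes).
`S = hubbardGridSub … (4M)`, `C₀ = C^K_{>e₀}`, `E₀ = sectorAnalysisMatrix β (klAnisoFamily … klE0 0)`, `wt = gridLabelWt L (4M) β`:
if `SᵀC₀S` is replica-Gram-bounded (`κ`) with `wt`-pair-weighted row / column sums `≤ α_w`, `θ_w = e·α_w·‖Ṽ‖_{h,wt}/κ² < 1` for the weighted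
profile of the grid vertex and a weight `ρ > 0`, and `E₀S` has `wt`-pair-weighted row / column sums `≤ cr_w / cc_w`, then for every `p ≥ 2`,
pinned leg `q` and field index `w`:
`klWtPinnedSum … K 0 (2p) q w ≤ ε_x^{2p-1}·cr_w·cc_w^{2p-1}·(ρ^{-2p}·e f₂·(eα_w f₂/κ²)^{p-2}/(1-θ_w)^p)`, `f₂ = (e²(κ+ρ))⁴·|U||β|/(4M)`. -/
theorem klWtPinnedSum_zero_le_of_wgridStep [NeZero M] {β : ℝ} (hβ : 0 < β) (U μ : ℝ) (K : TrigPolyC4v)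
    {κ : ℝ} (hκ : 0 < κ)
    (hGB : IsGramBoundedR ((hubbardGridSub L M β (2 * (2 * M))).transpose * hubbardCovAboveCT L M β μ 0 K klE0 *
      hubbardGridSub L M β (2 * (2 * M))) κ)
    {αw : ℝ} (hαw : 0 < αw)
    (hrow : ∀ X, ∑ Y, ‖((hubbardGridSub L M β (2 * (2 * M))).transpose * hubbardCovAboveCT L M β μ 0 K klE0 *
      hubbardGridSub L M β (2 * (2 * M))) X Y‖ * gridLabelWt L (2 * (2 * M)) β {gridLegPos X, gridLegPos Y} ≤ αw)
    (hcol : ∀ Y, ∑ X, ‖((hubbardGridSub L M β (2 * (2 * M))).transpose * hubbardCovAboveCT L M β μ 0 K klE0 *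
      hubbardGridSub L M β (2 * (2 * M))) X Y‖ * gridLabelWt L (2 * (2 * M)) β {gridLegPos X, gridLegPos Y} ≤ αw)
    {ρ : ℝ} (hρ : 0 < ρ)
    (hθ : Real.exp 1 * αw * normV (GridLeg (GridPoint L (2 * (2 * M)))) κ ρ
      (fun m' : ℕ => if m' = 1 then |β| / (2 * (2 * M) : ℕ) * ∑ z : TorusSite 2 L, ‖framePosKernel L K z‖ * (1 + torusSiteDist z 0)
        else if m' = 2 then |U| * |β| / (2 * (2 * M) : ℕ) else 0) / κ ^ 2 < 1)
    {crw ccw : ℝ} (hccw0 : 0 ≤ ccw)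
    (hrow' : ∀ X'' : SpaceTimeIdx L M × SectorLeg (sectorCount 0), ∑ X' : GridLeg (GridPoint L (2 * (2 * M))),
      ‖(sectorAnalysisMatrix L M β (klAnisoFamily L M β μ K klE0 0) * hubbardGridSub L M β (2 * (2 * M))) X'' X'‖ *
        gridLabelWt L (2 * (2 * M)) β {latticeLegPos (2 * (2 * M)) X'', gridLegPos X'} ≤ crw)
    (hcol' : ∀ X' : GridLeg (GridPoint L (2 * (2 * M))), ∑ X'' : SpaceTimeIdx L M × SectorLeg (sectorCount 0),
      ‖(sectorAnalysisMatrix L M β (klAnisoFamily L M β μ K klE0 0) * hubbardGridSub L M β (2 * (2 * M))) X'' X'‖ *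
        gridLabelWt L (2 * (2 * M)) β {latticeLegPos (2 * (2 * M)) X'', gridLegPos X'} ≤ ccw)
    {p : ℕ} (hp : 2 ≤ p) (q : Fin (2 * p)) (w : SpaceTimeIdx L M × SectorLeg (sectorCount 0)) :
    klWtPinnedSum L M β U μ K 0 (2 * p) q w ≤
      imagTimeWeight β M ^ (2 * p - 1) *
        (crw * ccw ^ (2 * p - 1) *
          (ρ⁻¹ ^ (2 * p) * (Real.exp 1 * ((Real.exp 2 * (κ + ρ)) ^ (2 * 2) * (|U| * |β| / (2 * (2 * M) : ℕ)))) *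
            (Real.exp 1 * αw * ((Real.exp 2 * (κ + ρ)) ^ (2 * 2) * (|U| * |β| / (2 * (2 * M) : ℕ))) / κ ^ 2) ^ (p - 2) /
              (1 - Real.exp 1 * αw * normV (GridLeg (GridPoint L (2 * (2 * M)))) κ ρ
                (fun m' : ℕ => if m' = 1 then |β| / (2 * (2 * M) : ℕ) * ∑ z : TorusSite 2 L, ‖framePosKernel L K z‖ * (1 + torusSiteDist z 0)
                  else if m' = 2 then |U| * |β| / (2 * (2 * M) : ℕ) else 0) / κ ^ 2) ^ p)) := by
  -- notation
  set Ng : ℕ := 2 * (2 * M) with hNg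
  haveI : NeZero Ng := ⟨by rw [hNg]; have := NeZero.ne M; omega⟩
  set S := hubbardGridSub L M β Ng with hS
  set C₀ := hubbardCovAboveCT L M β μ 0 K klE0 with hC₀
  set F₀ := klAnisoFamily L M β μ K klE0 0 with hF₀
  set E₀ := sectorAnalysisMatrix L M β F₀ with hE₀
  set Vt := hubbardGridInteraction L Ng β U + hubbardGridCounterQuadratic L Ng β K with hVt
  set wt := gridLabelWt L Ng β with hwt
  set Nw : ℕ → ℝ := fun m' : ℕ => if m' = 1 then |β| / Ng * ∑ z : TorusSite 2 L, ‖framePosKernel L K z‖ * (1 + torusSiteDist z 0)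
    else if m' = 2 then |U| * |β| / Ng else 0 with hNw
  have hwtree : IsTreeWeight wt := isTreeWeight_gridLabelWt L Ng hβ.le
  have hfS : LinearMap.toMatrix' (Matrix.toLin' S) = S := LinearMap.toMatrix'_toLin' S
  have hgE : LinearMap.toMatrix' (Matrix.toLin' E₀) = E₀ := LinearMap.toMatrix'_toLin' E₀
  have hVt_even : Vt ∈ evenPart ℂ (GridLeg (GridPoint L Ng)) :=
    add_mem (hubbardGridInteraction_mem_evenPart β U) (hubbardGridCounterQuadratic_mem_evenPart β K)
  have hVt0 : constPart ℂ Vt = 0 := by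
    rw [hVt, map_add, constPart_hubbardGridInteraction, constPart_hubbardGridCounterQuadratic, add_zero]
  have hNw2 : ∀ m', 2 < m' → Nw m' = 0 := fun m' hm' => by
    rw [hNw]; dsimp only; rw [if_neg (by omega), if_neg (by omega)]
  -- (1) the weighted bi-graded step, output degree `2p`, leg `q` pinned at `w`
  have hstep := (sum_wt_norm_kernel_map_effAction_le_biquartic_of_gramBounded hwtree gridLegPos (latticeLegPos Ng) C₀ (Matrix.toLin' S)
    (Matrix.toLin' E₀) Vt hVt_even hVt0 Nw (scaleZeroPinnedW_nonneg β U K)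
    (fun m' j w => sum_norm_kernel_gridVertex_mul_wt_le β U hβ.le K m' j w) hNw2 hκ (by rw [hfS]; exact hGB) hαw
    (by rw [hfS]; exact hrow) (by rw [hfS]; exact hcol) hρ hθ hccw0
    (fun X'' => by rw [hfS, hgE]; exact hrow' X'') (fun X' => by rw [hfS, hgE]; exact hcol' X') hp q w).2
  -- (2) the pinned sum in `klWtPinnedSum` currency: the action is the analysed step, the weight is dominated by `wt`
  rw [klWtPinnedSum_def, klEffectiveAction_zero_eq_effAction_map hβ.ne' U μ K]
  refine mul_le_mul_of_nonneg_left ?_ (pow_nonneg (imagTimeWeight_nonneg hβ.le M) _)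
  refine le_trans (sum_le_sum fun X _ => ?_) hstep
  exact mul_le_mul_of_nonneg_right (klScaleWt_zero_le_gridLabelWt β _) (norm_nonneg _)

/-! ## §4 Every positive degree: the full weighted step read through `E₀S` -/

/-- **(E1-W)₀ in every degree `m ≥ 1` from the FULL decay-weighted determinant-bounded step** (same three weighted sizes; used at
`m = 2`, where the kernel of `𝒱⁽⁰⁾` contains the counterterm and the tadpole):
`klWtPinnedSum … K 0 m q w ≤ ε_x^{m-1}·cr_w·cc_w^{m-1}·(ρ^{-m}·e‖Ṽ‖_{h,wt}/(1-θ_w))`, `‖Ṽ‖_{h,wt} = normV κ ρ N_w`. -/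
theorem klWtPinnedSum_zero_le_of_wgridStep_full [NeZero M] {β : ℝ} (hβ : 0 < β) (U μ : ℝ) (K : TrigPolyC4v)
    {κ : ℝ} (hκ : 0 < κ)
    (hGB : IsGramBoundedR ((hubbardGridSub L M β (2 * (2 * M))).transpose * hubbardCovAboveCT L M β μ 0 K klE0 *
      hubbardGridSub L M β (2 * (2 * M))) κ)
    {αw : ℝ} (hαw : 0 < αw)
    (hrow : ∀ X, ∑ Y, ‖((hubbardGridSub L M β (2 * (2 * M))).transpose * hubbardCovAboveCT L M β μ 0 K klE0 *
      hubbardGridSub L M β (2 * (2 * M))) X Y‖ * gridLabelWt L (2 * (2 * M)) β {gridLegPos X, gridLegPos Y} ≤ αw)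
    (hcol : ∀ Y, ∑ X, ‖((hubbardGridSub L M β (2 * (2 * M))).transpose * hubbardCovAboveCT L M β μ 0 K klE0 *
      hubbardGridSub L M β (2 * (2 * M))) X Y‖ * gridLabelWt L (2 * (2 * M)) β {gridLegPos X, gridLegPos Y} ≤ αw)
    {ρ : ℝ} (hρ : 0 < ρ)
    (hθ : Real.exp 1 * αw * normV (GridLeg (GridPoint L (2 * (2 * M)))) κ ρ
      (fun m' : ℕ => if m' = 1 then |β| / (2 * (2 * M) : ℕ) * ∑ z : TorusSite 2 L, ‖framePosKernel L K z‖ * (1 + torusSiteDist z 0)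
        else if m' = 2 then |U| * |β| / (2 * (2 * M) : ℕ) else 0) / κ ^ 2 < 1)
    {crw ccw : ℝ} (hccw0 : 0 ≤ ccw)
    (hrow' : ∀ X'' : SpaceTimeIdx L M × SectorLeg (sectorCount 0), ∑ X' : GridLeg (GridPoint L (2 * (2 * M))),
      ‖(sectorAnalysisMatrix L M β (klAnisoFamily L M β μ K klE0 0) * hubbardGridSub L M β (2 * (2 * M))) X'' X'‖ *
        gridLabelWt L (2 * (2 * M)) β {latticeLegPos (2 * (2 * M)) X'', gridLegPos X'} ≤ crw)
    (hcol' : ∀ X' : GridLeg (GridPoint L (2 * (2 * M))), ∑ X'' : SpaceTimeIdx L M × SectorLeg (sectorCount 0),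
      ‖(sectorAnalysisMatrix L M β (klAnisoFamily L M β μ K klE0 0) * hubbardGridSub L M β (2 * (2 * M))) X'' X'‖ *
        gridLabelWt L (2 * (2 * M)) β {latticeLegPos (2 * (2 * M)) X'', gridLegPos X'} ≤ ccw)
    {m : ℕ} (hm : 0 < m) (q : Fin m) (w : SpaceTimeIdx L M × SectorLeg (sectorCount 0)) :
    klWtPinnedSum L M β U μ K 0 m q w ≤
      imagTimeWeight β M ^ (m - 1) *
        (crw * ccw ^ (m - 1) *
          (ρ⁻¹ ^ m * (Real.exp 1 * normV (GridLeg (GridPoint L (2 * (2 * M)))) κ ρ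
              (fun m' : ℕ => if m' = 1 then |β| / (2 * (2 * M) : ℕ) * ∑ z : TorusSite 2 L, ‖framePosKernel L K z‖ * (1 + torusSiteDist z 0)
                else if m' = 2 then |U| * |β| / (2 * (2 * M) : ℕ) else 0)) /
            (1 - Real.exp 1 * αw * normV (GridLeg (GridPoint L (2 * (2 * M)))) κ ρ
              (fun m' : ℕ => if m' = 1 then |β| / (2 * (2 * M) : ℕ) * ∑ z : TorusSite 2 L, ‖framePosKernel L K z‖ * (1 + torusSiteDist z 0)
                else if m' = 2 then |U| * |β| / (2 * (2 * M) : ℕ) else 0) / κ ^ 2))) := by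
  -- notation
  set Ng : ℕ := 2 * (2 * M) with hNg
  haveI : NeZero Ng := ⟨by rw [hNg]; have := NeZero.ne M; omega⟩
  set S := hubbardGridSub L M β Ng with hS
  set C₀ := hubbardCovAboveCT L M β μ 0 K klE0 with hC₀
  set C' := S.transpose * C₀ * S with hC'
  set F₀ := klAnisoFamily L M β μ K klE0 0 with hF₀
  set E₀ := sectorAnalysisMatrix L M β F₀ with hE₀
  set Vt := hubbardGridInteraction L Ng β U + hubbardGridCounterQuadratic L Ng β K with hVt
  set wt := gridLabelWt L Ng β with hwt
  set Nw : ℕ → ℝ := fun m' : ℕ => if m' = 1 then |β| / Ng * ∑ z : TorusSite 2 L, ‖framePosKernel L K z‖ * (1 + torusSiteDist z 0)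
    else if m' = 2 then |U| * |β| / Ng else 0 with hNw
  have hwtree : IsTreeWeight wt := isTreeWeight_gridLabelWt L Ng hβ.le
  -- the weight pulled back to the grid legs
  have hwt' : IsTreeWeight (fun T : Finset (GridLeg (GridPoint L Ng)) => wt (T.image gridLegPos)) := hwtree.comap gridLegPos
  have hpair : ∀ X Y : GridLeg (GridPoint L Ng), (fun T : Finset (GridLeg (GridPoint L Ng)) => wt (T.image gridLegPos)) {X, Y} =
      wt {gridLegPos X, gridLegPos Y} := fun X Y => by simp only [image_insert, image_singleton]
  have hfS : LinearMap.toMatrix' (Matrix.toLin' S) = S := LinearMap.toMatrix'_toLin' S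
  have hgE : LinearMap.toMatrix' (Matrix.toLin' E₀) = E₀ := LinearMap.toMatrix'_toLin' E₀
  have hVt_even : Vt ∈ evenPart ℂ (GridLeg (GridPoint L Ng)) :=
    add_mem (hubbardGridInteraction_mem_evenPart β U) (hubbardGridCounterQuadratic_mem_evenPart β K)
  have hVt0 : constPart ℂ Vt = 0 := by
    rw [hVt, map_add, constPart_hubbardGridInteraction, constPart_hubbardGridCounterQuadratic, add_zero]
  -- (1) the full weighted step on the grid with covariance `C' = SᵀC₀S`
  obtain ⟨-, hfull⟩ := sum_wt_norm_kernel_effAction_le_of_gramBounded C' hwt' hκ hGB Vt hVt_even hVt0 Nw (scaleZeroPinnedW_nonneg β U K)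
    (fun m' j w => sum_norm_kernel_gridVertex_mul_wt_le β U hβ.le K m' j w) hαw
    (fun X => by simp only [hpair]; exact hrow X) (fun Y => by simp only [hpair]; exact hcol Y) hρ hθ
  have hθle : 0 ≤ 1 - Real.exp 1 * αw * normV (GridLeg (GridPoint L Ng)) κ ρ Nw / κ ^ 2 := sub_nonneg.2 hθ.le
  have hB0 : 0 ≤ ρ⁻¹ ^ m * (Real.exp 1 * normV (GridLeg (GridPoint L Ng)) κ ρ Nw) /
      (1 - Real.exp 1 * αw * normV (GridLeg (GridPoint L Ng)) κ ρ Nw / κ ^ 2) :=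
    div_nonneg (mul_nonneg (pow_nonneg (inv_nonneg.2 hρ.le) _)
      (mul_nonneg (Real.exp_pos 1).le (normV_nonneg hκ.le hρ.le (scaleZeroPinnedW_nonneg β U K)))) hθle
  have hfull' : ∀ (q' : Fin m) (x : GridLeg (GridPoint L Ng)),
      ∑ X ∈ univ.filter (fun X : Fin m → GridLeg (GridPoint L Ng) => X q' = x),
        ‖kernel ℂ (effAction ℂ C' Vt) m X‖ * wt ((univ.image X).image gridLegPos) ≤
          ρ⁻¹ ^ m * (Real.exp 1 * normV (GridLeg (GridPoint L Ng)) κ ρ Nw) /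
            (1 - Real.exp 1 * αw * normV (GridLeg (GridPoint L Ng)) κ ρ Nw / κ ^ 2) := by
    intro q' x
    exact (le_of_eq (sum_congr rfl fun X _ => mul_comm _ _)).trans (hfull hm q' x)
  -- (2) read through `E₀S` by the weighted Young step
  have hyoung := sum_filter_wt_norm_kernel_map_le_of_pos hwtree gridLegPos (latticeLegPos Ng)
    ((Matrix.toLin' E₀) ∘ₗ (Matrix.toLin' S)) hccw0
    (by intro X''; rw [LinearMap.toMatrix'_comp, hfS, hgE]; exact hrow' X'')
    (by intro X'; rw [LinearMap.toMatrix'_comp, hfS, hgE]; exact hcol' X') (effAction ℂ C' Vt) hm hB0 hfull' q w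
  -- (3) the pinned sum in `klWtPinnedSum` currency
  rw [klWtPinnedSum_def, klEffectiveAction_zero_eq_effAction_map hβ.ne' U μ K]
  refine mul_le_mul_of_nonneg_left ?_ (pow_nonneg (imagTimeWeight_nonneg hβ.le M) _)
  have hrepr : ExteriorAlgebra.map (Matrix.toLin' E₀) (effAction ℂ C₀ (ExteriorAlgebra.map (Matrix.toLin' S) Vt)) =
      ExteriorAlgebra.map ((Matrix.toLin' E₀) ∘ₗ (Matrix.toLin' S)) (effAction ℂ C' Vt) := by
    rw [effAction_map, hfS, map_map_eq_map_comp]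
  rw [hrepr]
  refine le_trans (sum_le_sum fun X _ => ?_) hyoung
  exact mul_le_mul_of_nonneg_right (klScaleWt_zero_le_gridLabelWt β _) (norm_nonneg _)

/-! ## §5 The assembly: `KernelNormsWt … K 0` for any budget dominating the two bounds -/

/-- **(E1-W)₀ — `KernelNormsWt L M N β U μ K 0` from ONE weighted determinant-bounded step, for ANY degree budget `N` dominating the
bi-graded bound in degrees `2p ≥ 4`, the full-step bound in degree `2`, and `0` in odd degrees** (modulo the three weighted sizes
α_w, cr_w/cc_w, θ_w < 1 — the same as (E4)₀'s `firstMoment_zero_le_of_wgridStep`). -/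
theorem kernelNormsWt_zero_of_wgridStep [NeZero M] {β : ℝ} (hβ : 0 < β) (U μ : ℝ) (K : TrigPolyC4v)
    {κ : ℝ} (hκ : 0 < κ)
    (hGB : IsGramBoundedR ((hubbardGridSub L M β (2 * (2 * M))).transpose * hubbardCovAboveCT L M β μ 0 K klE0 *
      hubbardGridSub L M β (2 * (2 * M))) κ)
    {αw : ℝ} (hαw : 0 < αw)
    (hrow : ∀ X, ∑ Y, ‖((hubbardGridSub L M β (2 * (2 * M))).transpose * hubbardCovAboveCT L M β μ 0 K klE0 *
      hubbardGridSub L M β (2 * (2 * M))) X Y‖ * gridLabelWt L (2 * (2 * M)) β {gridLegPos X, gridLegPos Y} ≤ αw)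
    (hcol : ∀ Y, ∑ X, ‖((hubbardGridSub L M β (2 * (2 * M))).transpose * hubbardCovAboveCT L M β μ 0 K klE0 *
      hubbardGridSub L M β (2 * (2 * M))) X Y‖ * gridLabelWt L (2 * (2 * M)) β {gridLegPos X, gridLegPos Y} ≤ αw)
    {ρ : ℝ} (hρ : 0 < ρ)
    (hθ : Real.exp 1 * αw * normV (GridLeg (GridPoint L (2 * (2 * M)))) κ ρ
      (fun m' : ℕ => if m' = 1 then |β| / (2 * (2 * M) : ℕ) * ∑ z : TorusSite 2 L, ‖framePosKernel L K z‖ * (1 + torusSiteDist z 0)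
        else if m' = 2 then |U| * |β| / (2 * (2 * M) : ℕ) else 0) / κ ^ 2 < 1)
    {crw ccw : ℝ} (hccw0 : 0 ≤ ccw)
    (hrow' : ∀ X'' : SpaceTimeIdx L M × SectorLeg (sectorCount 0), ∑ X' : GridLeg (GridPoint L (2 * (2 * M))),
      ‖(sectorAnalysisMatrix L M β (klAnisoFamily L M β μ K klE0 0) * hubbardGridSub L M β (2 * (2 * M))) X'' X'‖ *
        gridLabelWt L (2 * (2 * M)) β {latticeLegPos (2 * (2 * M)) X'', gridLegPos X'} ≤ crw)
    (hcol' : ∀ X' : GridLeg (GridPoint L (2 * (2 * M))), ∑ X'' : SpaceTimeIdx L M × SectorLeg (sectorCount 0),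
      ‖(sectorAnalysisMatrix L M β (klAnisoFamily L M β μ K klE0 0) * hubbardGridSub L M β (2 * (2 * M))) X'' X'‖ *
        gridLabelWt L (2 * (2 * M)) β {latticeLegPos (2 * (2 * M)) X'', gridLegPos X'} ≤ ccw)
    (N : ℕ → ℝ) (hNodd : ∀ m, Odd m → 0 ≤ N m)
    (hN2 : imagTimeWeight β M ^ (2 - 1) *
        (crw * ccw ^ (2 - 1) *
          (ρ⁻¹ ^ 2 * (Real.exp 1 * normV (GridLeg (GridPoint L (2 * (2 * M)))) κ ρ
              (fun m' : ℕ => if m' = 1 then |β| / (2 * (2 * M) : ℕ) * ∑ z : TorusSite 2 L, ‖framePosKernel L K z‖ * (1 + torusSiteDist z 0)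
                else if m' = 2 then |U| * |β| / (2 * (2 * M) : ℕ) else 0)) /
            (1 - Real.exp 1 * αw * normV (GridLeg (GridPoint L (2 * (2 * M)))) κ ρ
              (fun m' : ℕ => if m' = 1 then |β| / (2 * (2 * M) : ℕ) * ∑ z : TorusSite 2 L, ‖framePosKernel L K z‖ * (1 + torusSiteDist z 0)
                else if m' = 2 then |U| * |β| / (2 * (2 * M) : ℕ) else 0) / κ ^ 2))) ≤ N 2)
    (hNp : ∀ p, 2 ≤ p → imagTimeWeight β M ^ (2 * p - 1) *
        (crw * ccw ^ (2 * p - 1) *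
          (ρ⁻¹ ^ (2 * p) * (Real.exp 1 * ((Real.exp 2 * (κ + ρ)) ^ (2 * 2) * (|U| * |β| / (2 * (2 * M) : ℕ)))) *
            (Real.exp 1 * αw * ((Real.exp 2 * (κ + ρ)) ^ (2 * 2) * (|U| * |β| / (2 * (2 * M) : ℕ))) / κ ^ 2) ^ (p - 2) /
              (1 - Real.exp 1 * αw * normV (GridLeg (GridPoint L (2 * (2 * M)))) κ ρ
                (fun m' : ℕ => if m' = 1 then |β| / (2 * (2 * M) : ℕ) * ∑ z : TorusSite 2 L, ‖framePosKernel L K z‖ * (1 + torusSiteDist z 0)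
                  else if m' = 2 then |U| * |β| / (2 * (2 * M) : ℕ) else 0) / κ ^ 2) ^ p)) ≤ N (2 * p)) :
    KernelNormsWt L M N β U μ K 0 := by
  intro m q w
  rcases Nat.even_or_odd m with he | ho
  · obtain ⟨p, rfl⟩ := he
    rcases p with _ | _ | p
    · exact q.elim0
    · exact (klWtPinnedSum_zero_le_of_wgridStep_full hβ U μ K hκ hGB hαw hrow hcol hρ hθ hccw0 hrow' hcol' (by norm_num) q w).trans hN2
    · revert q
      rw [← two_mul]
      intro q
      exact (klWtPinnedSum_zero_le_of_wgridStep hβ U μ K hκ hGB hαw hrow hcol hρ hθ hccw0 hrow' hcol' (by omega) q w).trans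
        (hNp (p + 2) (by omega))
  · rw [klWtPinnedSum_zero_eq_zero_of_odd hβ.ne' U μ K ho q w]
    exact hNodd m ho

end Summit.HubbardSuperconductivity.HubbardSuperconductivity.Theorems.EngineV8

end
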